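import Literature.AlgebraicGeometry.Modules.BoxTensor
import Literature.AlgebraicGeometry.Modules.DetClassOfIso
import Literature.AlgebraicGeometry.Modules.InvertibleOfRankOne
import Mathlib.CategoryTheory.Adjunction.Limits
import HarnessLib

/-!
# Invertible `𝒪`-modules: a locally free module of rank one is invertible (The Stacks Project, Tags 01CS, 0B8M) — definition + NAMED FACT

Layer `Literature/AlgebraicGeometry/Modules`; namespace `Literature.AlgebraicGeometry.Modules`. One DEFINITION (Stacks' notion of an invertible
module, verbatim), one NAMED FACT (D-0014), and the sorry-free consequences of invertibility the consumers use (exactness of `L ⊗ –`); no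
instance, no notation.

Source, verbatim (The Stacks Project, Chapter *Sheaves of Modules*, §17.25 Invertible modules): "Definition 17.25.1 (Tag 01CS). Let
`(X, 𝒪_X)` be a ringed space. An invertible `𝒪_X`-module is a sheaf of `𝒪_X`-modules `𝓛` such that the functor `Mod(𝒪_X) → Mod(𝒪_X)`,
`𝓕 ↦ 𝓛 ⊗_{𝒪_X} 𝓕` is an equivalence of categories." — "Lemma 17.25.4 (Tag 0B8M). Let `(X, 𝒪_X)` be a ringed space. Any locally free
`𝒪_X`-module of rank `1` is invertible. If all stalks `𝒪_{X,x}` are local rings, then the converse holds as well (but in general this is not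
the case)." (Proof loc. cit.: the evaluation map `𝓛 ⊗ 𝓗om(𝓛, 𝒪_X) → 𝒪_X` is an isomorphism, checked on a trivialising cover; then Lemma
17.25.2 (Tag 0B8K): `– ⊗ 𝓝` is a quasi-inverse.)

In the tree's vocabulary: `𝓛 ⊗ –` is `(Modules.tensorBifunctor X).obj L` (`Modules/BoxTensor`, over the sheafified tensor product
`Modules.tensorObj` of `Modules/TensorProduct`, Stacks 01CA); "locally free of rank `1`" is `Motives.IsFiniteLocallyFree L ∧ Motives.HasRank L 1`
(`Motives/HodgeSheaves`, `Motives/CrystallineRealization`); "equivalence of categories" is Mathlib's `Functor.IsEquivalence` (a `Prop`).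

* `IsInvertibleModule L` — Definition 17.25.1 verbatim (a `Prop`-valued predicate).
* `LocallyFreeRankOneIsInvertible` — Lemma 17.25.4, first sentence, as a NAMED FACT (not proved here: the proof needs the associator of `⊗`
  and the evaluation isomorphism `𝓛 ⊗ 𝓛^∨ ≅ 𝒪_X`, equivalently the compatibility of sheafification with the presheaf tensor product, which
  `Modules/TensorProduct` deliberately does not construct; line card `Lines/NowhereDisplaceable.md` rev 6.1 § (4d) of the Hodge road №4).
* Consequences (proved): an invertible `L` has `L ⊗ –` additive and EXACT (`IsInvertibleModule.additive`, `.preservesFiniteLimits`,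
  `.preservesFiniteColimits` — an equivalence preserves all limits and colimits), faithful and full.
* `LocallyFreeRankOneIsInvertible_holds` — **the DISCHARGE of the named fact** (appended): `Modules/InvertibleOfRankOne` proves
  `isEquivalence_tensorBifunctor_obj_of_hasRank_one` by an associator-free road (`L ⊗ E ≅ 𝓗om(L^∨, E)`, Hartshorne II Ex. 5.1 (b),
  `Modules/TensorSheafHomIso`; the rank-one contraction `𝓗om(L, 𝓗om(L^∨, –)) ≅ 𝟭`; quasi-inverses `𝓗om(L, –)` and `L^∨ ⊗ –`),
  so consumers feed `LocallyFreeRankOneIsInvertible_holds` where they took `(h : LocallyFreeRankOneIsInvertible)`.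

Consumer: road №4 of the Hodge atlas, crux stmt-HodgeConjecture-26512, route «2T» step (i) (`Theorems/VHCAbelianSchemesRoadExtJumpLocusLinearisedTwist`,
instance hypothesis `[(N ⊗ –).IsEquivalence]`); library only — proves nothing about (N-U), 26512, №4, HC_AV or HC.

-- TODO(general form): ringed spaces; Lemma 17.25.2 (Tag 0B8K: invertible ⟺ `∃ 𝓝, 𝓛 ⊗ 𝓝 ≅ 𝒪_X`, and then `𝓝 ≅ 𝓗om(𝓛, 𝒪_X)`), Lemma 17.25.3
-- (Tag 0B8L: pull-backs of invertible modules are invertible), the converse of 17.25.4 on locally ringed spaces, and `Pic` (Tag 01CW ff.).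

## References

* The Stacks Project, Tag 01CS (Modules, Definition 17.25.1), Tag 0B8M (Lemma 17.25.4), Tag 0B8K (Lemma 17.25.2), Tag 01CA. [StacksProject]
* R. Hartshorne, *Algebraic Geometry* (1977), II §6 p. 143 (invertible sheaves, `Pic X`). [Hartshorne1977]
-/

noncomputable section

open CategoryTheory CategoryTheory.Limits AlgebraicGeometry MonoidalCategory

universe u

namespace Literature.AlgebraicGeometry.Modules

variable {X : Scheme.{u}}

/-- **An invertible `𝒪_X`-module** (The Stacks Project, Definition 17.25.1, Tag 01CS, verbatim): "a sheaf of `𝒪_X`-modules `𝓛` such that the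
functor `Mod(𝒪_X) → Mod(𝒪_X)`, `𝓕 ↦ 𝓛 ⊗_{𝒪_X} 𝓕` is an equivalence of categories" — `𝓛 ⊗ –` being the tree's `(Modules.tensorBifunctor X).obj L`.
[cite: StacksProject, Tag 01CS (Modules, Definition 17.25.1)] -/
def IsInvertibleModule (L : X.Modules) : Prop :=
  ((tensorBifunctor X).obj L).IsEquivalence

/-- **The Stacks Project, Tag 0B8M (Modules, Lemma 17.25.4), first sentence — a locally free module of rank `1` is invertible**: "Let
`(X, 𝒪_X)` be a ringed space. Any locally free `𝒪_X`-module of rank `1` is invertible." Here for schemes, with "locally free of rank `1`" read as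
`IsFiniteLocallyFree L ∧ HasRank L 1`. A NAMED FACT, not proved here; users take `(h : LocallyFreeRankOneIsInvertible)`.
[cite: StacksProject, Tag 0B8M (Modules, Lemma 17.25.4)] -/
def LocallyFreeRankOneIsInvertible : Prop :=
  ∀ ⦃X : Scheme.{u}⦄ (L : X.Modules), Motives.IsFiniteLocallyFree L → Motives.HasRank L 1 → IsInvertibleModule L

/-! ### Consequences of invertibility (proved) -/

-- `TopCat.Presheaf`/`Scheme.Modules` are not reducible (as in Mathlib's `AlgebraicGeometry/Modules/Sheaf.lean`): the rewrite
-- `Functor.map_add` below is only type-correct after unfolding `X.ringCatSheaf`.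
set_option backward.isDefEq.respectTransparency false in
/-- **`L ⊗ –` is additive** for every `𝒪_X`-module `L` (no invertibility needed): `𝟙_L ⊗ (g + g') = 𝟙_L ⊗ g + 𝟙_L ⊗ g'` objectwise
(`MonoidalPreadditive` in `ModuleCat`), and the sheafification functor — a left adjoint of the additive forgetful functor — is additive.
[cite: StacksProject, Tag 01CA] -/
theorem additive_tensorBifunctor_obj (L : X.Modules) : ((tensorBifunctor X).obj L).Additive := by
  haveI : (Scheme.Modules.toPresheafOfModules X).Additive := inferInstanceAs (SheafOfModules.forget _).Additive
  haveI : (modulesSheafify X).Additive := (modulesSheafifyAdjunction X).left_adjoint_additive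
  refine ⟨fun {M M'} {g g'} => ?_⟩
  change tensorMap (𝟙 L) (g + g') = tensorMap (𝟙 L) g + tensorMap (𝟙 L) g'
  simp only [tensorMap]
  have h : (homToCommRingedPresheaf (𝟙 L) ⊗ₘ homToCommRingedPresheaf (g + g') :
      (toCommRingedPresheaf L ⊗ toCommRingedPresheaf M : CommRingedPresheafOfModules X) ⟶
        (toCommRingedPresheaf L ⊗ toCommRingedPresheaf M')) =
      (homToCommRingedPresheaf (𝟙 L) ⊗ₘ homToCommRingedPresheaf g) + (homToCommRingedPresheaf (𝟙 L) ⊗ₘ homToCommRingedPresheaf g') := by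
    apply PresheafOfModules.hom_ext
    intro U
    change (homToCommRingedPresheaf (𝟙 L)).app U ⊗ₘ ((homToCommRingedPresheaf g).app U + (homToCommRingedPresheaf g').app U) = _
    rw [MonoidalPreadditive.tensor_add]
    rfl
  rw [h, Functor.map_add]

namespace IsInvertibleModule

variable {L : X.Modules}

/-- An invertible module has `L ⊗ –` an equivalence (the definition, as an instance-shaped statement). [cite: StacksProject, Tag 01CS (Modules, Definition 17.25.1)] -/
theorem isEquivalence (h : IsInvertibleModule L) : ((tensorBifunctor X).obj L).IsEquivalence := h

/-- `L ⊗ –` is faithful for an invertible `L`. [cite: StacksProject, Tag 01CS (Modules, Definition 17.25.1)] -/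
theorem faithful (h : IsInvertibleModule L) : ((tensorBifunctor X).obj L).Faithful := by
  haveI := h.isEquivalence; infer_instance

/-- `L ⊗ –` is full for an invertible `L`. [cite: StacksProject, Tag 01CS (Modules, Definition 17.25.1)] -/
theorem full (h : IsInvertibleModule L) : ((tensorBifunctor X).obj L).Full := by
  haveI := h.isEquivalence; infer_instance

/-- `L ⊗ –` is essentially surjective for an invertible `L` (every module is a twist). [cite: StacksProject, Tag 01CS (Modules, Definition 17.25.1)] -/
theorem essSurj (h : IsInvertibleModule L) : ((tensorBifunctor X).obj L).EssSurj := by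
  haveI := h.isEquivalence; infer_instance

/-- **`L ⊗ –` is left exact for an invertible `L`** (an equivalence preserves all limits). [cite: StacksProject, Tag 01CS (Modules, Definition 17.25.1)] -/
theorem preservesFiniteLimits (h : IsInvertibleModule L) : PreservesFiniteLimits ((tensorBifunctor X).obj L) := by
  haveI := h.isEquivalence; infer_instance

/-- **`L ⊗ –` is right exact for an invertible `L`** (an equivalence preserves all colimits). [cite: StacksProject, Tag 01CS (Modules, Definition 17.25.1)] -/
theorem preservesFiniteColimits (h : IsInvertibleModule L) : PreservesFiniteColimits ((tensorBifunctor X).obj L) := by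
  haveI := h.isEquivalence; infer_instance

end IsInvertibleModule

/-- Unfolding the fact at a finite locally free module of rank one. [cite: StacksProject, Tag 0B8M (Modules, Lemma 17.25.4)] -/
theorem LocallyFreeRankOneIsInvertible.isEquivalence (h : LocallyFreeRankOneIsInvertible.{u}) {L : X.Modules}
    (hL : Motives.IsFiniteLocallyFree L) (h₁ : Motives.HasRank L 1) : ((tensorBifunctor X).obj L).IsEquivalence :=
  h L hL h₁

/-! ### Discharge -/

/-- **The Stacks Project, Tag 0B8M, first sentence, PROVED for the tree's `tensorObj`**: every finite locally free `𝒪_X`-module of rank one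
is invertible — `Modules/InvertibleOfRankOne.isEquivalence_tensorBifunctor_obj_of_hasRank_one` (left quasi-inverse `𝓗om(L, –)`, right
quasi-inverse `L^∨ ⊗ –`, through `L ⊗ E ≅ 𝓗om(L^∨, E)` and the rank-one contraction; no associator of `⊗` is used). This discharges the
named fact `LocallyFreeRankOneIsInvertible`. [cite: StacksProject, Tag 0B8M (Modules, Lemma 17.25.4)] [cite: Hartshorne1977, II Ex. 5.1 (b) (p. 123)] -/
theorem LocallyFreeRankOneIsInvertible_holds : LocallyFreeRankOneIsInvertible.{u} :=
  fun _ _ hL h₁ => isEquivalence_tensorBifunctor_obj_of_hasRank_one hL h₁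

/-- Hence every finite locally free module of rank one is an invertible module (Definition 17.25.1), unconditionally.
[cite: StacksProject, Tag 0B8M (Modules, Lemma 17.25.4)] -/
theorem isInvertibleModule_of_hasRank_one {L : X.Modules} (hL : Motives.IsFiniteLocallyFree L) (h₁ : Motives.HasRank L 1) :
    IsInvertibleModule L :=
  LocallyFreeRankOneIsInvertible_holds L hL h₁

end Literature.AlgebraicGeometry.Modules

end
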